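import Summits.CriticalPhenomena.PercolationContinuityZ3.Theorems.PercNearOneGluingNearOneGluingS2OfS2M

/-!
# Crux `PercNearOneGluing.NearOneGluing` (stmt-CriticalPhenomena-4574), line `SketchR2I5` —
# the exchange inequality S1-gen from its sharp-constant form EXCH_M

Lead prover-line-stmt-CriticalPhenomena-4574-c8 (cycle 8, wave 1, stub `stub_s1genOfExchM`).  Lands
`--supports stmt-CriticalPhenomena-4574`; no definitions, no named facts.

## Content

Finite weighted graph on `Fin n`, `μ = prodBernoulli w`, `{u ↔ v} = openConn u v`, `C_y(ω) = openEdgeCluster ω y`.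
Notation: `D := {y ↮ z}`, `D_a := {x ↮ y} ∩ {x ↮ z}`, `W := D_a ∩ {o ↔ x}`, `N := D_a ∩ D` (the three relays
pairwise separated), and for a vertex `v` and a function `G` of the edge cluster of `y`
`slack_v(G) := μ(D)·∫_{{v↔y}∩D} G(C_y) dμ − μ({v↔y}∩D)·∫_D G(C_y) dμ` (`= μ(D)²·Cov_D(1{v ∈ C_y}, G(C_y))`).

* `s1m_slack_nonneg`: `slack_v(G) ≥ 0` for `G` increasing — van den Berg–Häggström–Kahn Thm. 1.3 for the
  source `y`, the avoided set `X = {z}` and the pair `F = 1{v ∈ C}` (`connIndicatorFn y v`), `G`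
  (no sign condition on `G` is needed: the vendored Thm. 1.3 only asks `F`, `G` monotone).
* `s1m_s1gen_of_exchM`: if `μ({o↔x} ∩ N)·slack_x(G) ≤ μ(N)·slack_o(G)` (EXCH_M, the registered `stub_exchM`,
  constant `θ_M = P(o↔x | N)`) then `μ(W)·slack_x(G) ≤ μ(D_a)·slack_o(G)` (S1-gen, the registered `stub_s1gen`,
  constant `θ = P(o↔x | D_a) ≤ θ_M`): multiply by `μ(N)` and chain `θ ≤ θ_M` (`s2red_theta_le_thetaM`:
  `μ(W)μ(N) ≤ μ({o↔x}∩N)μ(D_a)`) with `slack_x(G) ≥ 0` and EXCH_M; when `μ(N) = 0`, Harris (`s2red_harris_N`: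
  `μ(D_a)μ(D) ≤ μ(N)`) gives `μ(D_a) = 0` (so `μ(W) = 0`) or `μ(D) = 0` (so both slacks vanish).
* `stub_s1genOfExchM`: the registered-signature form (all graphs, all `o x y z` with `x, y, z` distinct).
[cite: VandenbergHaggstromKahn2005, Thm. 1.3 (p. 6)] [cite: KozmaNitzan2024, Question 7 (p. 36)]
-/

namespace Summit.CriticalPhenomena.PercolationContinuityZ3.Theorems

open MeasureTheory Set Literature.Probability.LatticeModels Literature.Probability.Percolation
open scoped Classical
open Q7ThreeCut

noncomputable section

variable {n : ℕ}

/-- **`slack_v(G) ≥ 0`**: `μ({v↔y} ∩ D)·∫_D G(C_y) ≤ μ(D)·∫_{{v↔y}∩D} G(C_y)` for `D = {y ↮ z}` and `G`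
increasing — BHK Thm. 1.3 with source `y`, `X = {z}`, `F = 1{v ∈ C_y}` (`connIndicatorFn y v`) and `G`.
[cite: VandenbergHaggstromKahn2005, Thm. 1.3 (p. 6)] -/
theorem s1m_slack_nonneg (w : Sym2 (Fin n) → unitInterval) (v y z : Fin n) (hyz : y ≠ z)
    (G : Set (Sym2 (Fin n)) → ℝ) (hG : Monotone G) :
    (prodBernoulli w).real (openConn v y ∩ (openConn y z)ᶜ) *
        (∫ ω in (openConn y z)ᶜ, G (openEdgeCluster ω y) ∂(prodBernoulli w)) ≤
      (prodBernoulli w).real (openConn y z)ᶜ *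
        (∫ ω in openConn v y ∩ (openConn y z)ᶜ, G (openEdgeCluster ω y) ∂(prodBernoulli w)) := by
  have key := BHK2006_clusterConditionalPositiveAssociation_holds (Fin n) w y ({z} : Set (Fin n))
    (connIndicatorFn y v) G (monotone_connIndicatorFn y v) hG
    (fun h => hyz (Set.mem_singleton_iff.1 h))
  have hD : {ω : BondConfig (Fin n) | ∀ q ∈ ({z} : Set (Fin n)), ¬ (openGraph ω).Reachable y q} =
      (openConn y z)ᶜ := by
    ext ω
    simp only [Set.mem_setOf_eq, Set.mem_singleton_iff, forall_eq, Set.mem_compl_iff]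
    rfl
  have hprod : ∀ ω : BondConfig (Fin n),
      (openConn y v : Set (BondConfig (Fin n))).indicator (1 : BondConfig (Fin n) → ℝ) ω *
          G (openEdgeCluster ω y) =
        (openConn y v : Set (BondConfig (Fin n))).indicator (fun ω' => G (openEdgeCluster ω' y)) ω := by
    intro ω
    by_cases h : ω ∈ (openConn y v : Set (BondConfig (Fin n)))
    · rw [indicator_of_mem h, indicator_of_mem h, Pi.one_apply, one_mul]
    · rw [indicator_of_notMem h, indicator_of_notMem h, zero_mul]
  simp only [connIndicatorFn_openEdgeCluster, hD, hprod] at key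
  rw [setIntegral_indicator_one_eq,
    setIntegral_indicator (MeasurableSet.of_discrete : MeasurableSet (openConn y v : Set (BondConfig (Fin n)))),
    knThm2_openConn_comm y v] at key
  have e1 : ((openConn y z)ᶜ ∩ openConn v y : Set (BondConfig (Fin n))) = openConn v y ∩ (openConn y z)ᶜ :=
    inter_comm _ _
  rw [e1] at key
  exact key

/-- **S1-gen from EXCH_M** (pointwise in the graph and in `G`).  If
`μ({o↔x} ∩ N)·slack_x(G) ≤ μ(N)·slack_o(G)` then `μ(W)·slack_x(G) ≤ μ(D_a)·slack_o(G)`: multiply the goal by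
`μ(N)`; `μ(N)μ(W)·slack_x ≤ μ({o↔x}∩N)μ(D_a)·slack_x ≤ μ(D_a)μ(N)·slack_o` by `θ ≤ θ_M`, `slack_x ≥ 0` and the
hypothesis; if `μ(N) = 0` then `μ(D_a)μ(D) = 0` (Harris) and both sides vanish.
[cite: KozmaNitzan2024, Question 7 (p. 36)] -/
theorem s1m_s1gen_of_exchM (w : Sym2 (Fin n) → unitInterval) (o x y z : Fin n) (hyz : y ≠ z)
    (G : Set (Sym2 (Fin n)) → ℝ) (hG : Monotone G)
    (hM : (prodBernoulli w).real (openConn o x ∩ ((openConn x y)ᶜ ∩ (openConn x z)ᶜ ∩ (openConn y z)ᶜ)) *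
        ((prodBernoulli w).real (openConn y z)ᶜ *
            (∫ ω in openConn x y ∩ (openConn y z)ᶜ, G (openEdgeCluster ω y) ∂(prodBernoulli w)) -
          (prodBernoulli w).real (openConn x y ∩ (openConn y z)ᶜ) *
            (∫ ω in (openConn y z)ᶜ, G (openEdgeCluster ω y) ∂(prodBernoulli w))) ≤
      (prodBernoulli w).real ((openConn x y)ᶜ ∩ (openConn x z)ᶜ ∩ (openConn y z)ᶜ) *
        ((prodBernoulli w).real (openConn y z)ᶜ *
            (∫ ω in openConn o y ∩ (openConn y z)ᶜ, G (openEdgeCluster ω y) ∂(prodBernoulli w)) -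
          (prodBernoulli w).real (openConn o y ∩ (openConn y z)ᶜ) *
            (∫ ω in (openConn y z)ᶜ, G (openEdgeCluster ω y) ∂(prodBernoulli w)))) :
    (prodBernoulli w).real (((openConn x y)ᶜ ∩ (openConn x z)ᶜ) ∩ openConn o x) *
        ((prodBernoulli w).real (openConn y z)ᶜ *
            (∫ ω in openConn x y ∩ (openConn y z)ᶜ, G (openEdgeCluster ω y) ∂(prodBernoulli w)) -
          (prodBernoulli w).real (openConn x y ∩ (openConn y z)ᶜ) *
            (∫ ω in (openConn y z)ᶜ, G (openEdgeCluster ω y) ∂(prodBernoulli w))) ≤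
      (prodBernoulli w).real ((openConn x y)ᶜ ∩ (openConn x z)ᶜ) *
        ((prodBernoulli w).real (openConn y z)ᶜ *
            (∫ ω in openConn o y ∩ (openConn y z)ᶜ, G (openEdgeCluster ω y) ∂(prodBernoulli w)) -
          (prodBernoulli w).real (openConn o y ∩ (openConn y z)ᶜ) *
            (∫ ω in (openConn y z)ᶜ, G (openEdgeCluster ω y) ∂(prodBernoulli w))) := by
  -- the three inputs, taken before abbreviating
  have htilt := s2red_theta_le_thetaM w o x y z
  have hhar := s2red_harris_N w x y z
  have hsx := s1m_slack_nonneg w x y z hyz G hG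
  have hA_le : (prodBernoulli w).real (((openConn x y)ᶜ ∩ (openConn x z)ᶜ) ∩ openConn o x) ≤
      (prodBernoulli w).real ((openConn x y)ᶜ ∩ (openConn x z)ᶜ) := measureReal_mono inter_subset_left
  have hqx_le : (prodBernoulli w).real (openConn x y ∩ (openConn y z)ᶜ) ≤ (prodBernoulli w).real (openConn y z)ᶜ :=
    measureReal_mono inter_subset_right
  have hqo_le : (prodBernoulli w).real (openConn o y ∩ (openConn y z)ᶜ) ≤ (prodBernoulli w).real (openConn y z)ᶜ :=
    measureReal_mono inter_subset_right
  have hA0 : 0 ≤ (prodBernoulli w).real (((openConn x y)ᶜ ∩ (openConn x z)ᶜ) ∩ openConn o x) := measureReal_nonneg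
  have hDa0 : 0 ≤ (prodBernoulli w).real ((openConn x y)ᶜ ∩ (openConn x z)ᶜ) := measureReal_nonneg
  have hN0 : 0 ≤ (prodBernoulli w).real ((openConn x y)ᶜ ∩ (openConn x z)ᶜ ∩ (openConn y z)ᶜ) := measureReal_nonneg
  have hox0 : 0 ≤ (prodBernoulli w).real (openConn o x ∩ ((openConn x y)ᶜ ∩ (openConn x z)ᶜ ∩ (openConn y z)ᶜ)) :=
    measureReal_nonneg
  have hd0 : 0 ≤ (prodBernoulli w).real (openConn y z)ᶜ := measureReal_nonneg
  have hqx0 : 0 ≤ (prodBernoulli w).real (openConn x y ∩ (openConn y z)ᶜ) := measureReal_nonneg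
  have hqo0 : 0 ≤ (prodBernoulli w).real (openConn o y ∩ (openConn y z)ᶜ) := measureReal_nonneg
  -- abbreviations
  generalize (prodBernoulli w).real (((openConn x y)ᶜ ∩ (openConn x z)ᶜ) ∩ openConn o x) = A at *
  generalize (prodBernoulli w).real ((openConn x y)ᶜ ∩ (openConn x z)ᶜ ∩ (openConn y z)ᶜ) = Nn at *
  generalize (prodBernoulli w).real (openConn o x ∩ ((openConn x y)ᶜ ∩ (openConn x z)ᶜ ∩ (openConn y z)ᶜ)) = oxN at *
  generalize (prodBernoulli w).real ((openConn x y)ᶜ ∩ (openConn x z)ᶜ) = Da at *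
  generalize (prodBernoulli w).real (openConn x y ∩ (openConn y z)ᶜ) = qx at *
  generalize (prodBernoulli w).real (openConn o y ∩ (openConn y z)ᶜ) = qo at *
  generalize (prodBernoulli w).real (openConn y z)ᶜ = d at *
  generalize (∫ ω in openConn x y ∩ (openConn y z)ᶜ, G (openEdgeCluster ω y) ∂(prodBernoulli w)) = Ix at *
  generalize (∫ ω in openConn o y ∩ (openConn y z)ᶜ, G (openEdgeCluster ω y) ∂(prodBernoulli w)) = Io at *
  generalize (∫ ω in (openConn y z)ᶜ, G (openEdgeCluster ω y) ∂(prodBernoulli w)) = I at *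
  -- main inequality multiplied by μ(N)
  have hsx' : 0 ≤ d * Ix - qx * I := by linarith
  have key : Nn * (A * (d * Ix - qx * I)) ≤ Nn * (Da * (d * Io - qo * I)) := by
    nlinarith [mul_le_mul_of_nonneg_right htilt hsx', mul_le_mul_of_nonneg_left hM hDa0]
  by_cases hN : Nn = 0
  · -- degenerate case: μ(D_a)·μ(D) = 0
    have hprod : Da * d = 0 := le_antisymm (by simpa [hN] using hhar) (mul_nonneg hDa0 hd0)
    rcases mul_eq_zero.1 hprod with hDa_z | hd_z
    · have hA_z : A = 0 := le_antisymm (by simpa [hDa_z] using hA_le) hA0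
      rw [hA_z, hDa_z]; simp
    · have hqx_z : qx = 0 := le_antisymm (by simpa [hd_z] using hqx_le) hqx0
      have hqo_z : qo = 0 := le_antisymm (by simpa [hd_z] using hqo_le) hqo0
      rw [hd_z, hqx_z, hqo_z]; simp
  · have hNpos : 0 < Nn := lt_of_le_of_ne hN0 (Ne.symm hN)
    exact le_of_mul_le_mul_left key hNpos

/-- **Registered reduction stub** `stub_s1genOfExchM`: the sharp-constant exchange inequality EXCH_M (registered
`stub_exchM`, constant `θ_M = P(o↔x | x↮y, x↮z, y↮z)`) for all graphs, vertices and increasing `G` implies the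
exchange inequality S1-gen (registered `stub_s1gen`, constant `θ = P(o↔x | x↮y, x↮z)`) for all of them —
pointwise `s1m_s1gen_of_exchM`. [cite: KozmaNitzan2024, Question 7 (p. 36)] -/
theorem stub_s1genOfExchM :
    (∀ (n : ℕ) (w : Sym2 (Fin n) → unitInterval) (o x y z : Fin n), x ≠ y → x ≠ z → y ≠ z → ∀ G : Set (Sym2 (Fin n)) → ℝ, Monotone G → (Literature.Probability.LatticeModels.prodBernoulli w).real (Literature.Probability.Percolation.openConn o x ∩ ((Literature.Probability.Percolation.openConn x y)ᶜ ∩ (Literature.Probability.Percolation.openConn x z)ᶜ ∩ (Literature.Probability.Percolation.openConn y z)ᶜ)) * ((Literature.Probability.LatticeModels.prodBernoulli w).real (Literature.Probability.Percolation.openConn y z)ᶜ * (∫ ω in Literature.Probability.Percolation.openConn x y ∩ (Literature.Probability.Percolation.openConn y z)ᶜ, G (Literature.Probability.Percolation.openEdgeCluster ω y) ∂(Literature.Probability.LatticeModels.prodBernoulli w)) - (Literature.Probability.LatticeModels.prodBernoulli w).real (Literature.Probability.Percolation.openConn x y ∩ (Literature.Probability.Percolation.openConn y z)ᶜ) * (∫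 ω in (Literature.Probability.Percolation.openConn y z)ᶜ, G (Literature.Probability.Percolation.openEdgeCluster ω y) ∂(Literature.Probability.LatticeModels.prodBernoulli w))) ≤ (Literature.Probability.LatticeModels.prodBernoulli w).real ((Literature.Probability.Percolation.openConn x y)ᶜ ∩ (Literature.Probability.Percolation.openConn x z)ᶜ ∩ (Literature.Probability.Percolation.openConn y z)ᶜ) * ((Literature.Probability.LatticeModels.prodBernoulli w).real (Literature.Probability.Percolation.openConn y z)ᶜ * (∫ ω in Literature.Probability.Percolation.openConn o y ∩ (Literature.Probability.Percolation.openConn y z)ᶜ, G (Literature.Probability.Percolation.openEdgeCluster ω y) ∂(Literature.Probability.LatticeModels.prodBernoulli w)) - (Literature.Probability.LatticeModels.prodBernoulli w).real (Literature.Probability.Percolation.openConn o y ∩ (Literature.Probability.Percolation.openConn y z)ᶜ) * (∫ ω in (Literature.Probability.Percolation.openConn y z)ᶜ, G (Literature.Probability.Percolation.openEdgeCluster ω y) ∂(Literature.Probability.LatticeModels.prodBernoulli w)))) →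
    ∀ (n : ℕ) (w : Sym2 (Fin n) → unitInterval) (o x y z : Fin n), x ≠ y → x ≠ z → y ≠ z → ∀ G : Set (Sym2 (Fin n)) → ℝ, Monotone G → (Literature.Probability.LatticeModels.prodBernoulli w).real (((Literature.Probability.Percolation.openConn x y)ᶜ ∩ (Literature.Probability.Percolation.openConn x z)ᶜ) ∩ Literature.Probability.Percolation.openConn o x) * ((Literature.Probability.LatticeModels.prodBernoulli w).real (Literature.Probability.Percolation.openConn y z)ᶜ * (∫ ω in Literature.Probability.Percolation.openConn x y ∩ (Literature.Probability.Percolation.openConn y z)ᶜ, G (Literature.Probability.Percolation.openEdgeCluster ω y) ∂(Literature.Probability.LatticeModels.prodBernoulli w)) - (Literature.Probability.LatticeModels.prodBernoulli w).real (Literature.Probability.Percolation.openConn x y ∩ (Literature.Probability.Percolation.openConn y z)ᶜ) * (∫ ω in (Literature.Probability.Percolation.openConn y z)ᶜ, G (Literature.Probability.Percolation.openEdgeCluster ω y) ∂(Literature.Probability.LatticeModels.prodBernoulli w))) ≤ (Literature.Probability.LatticeModels.prodBernoulli w).real ((Literature.Probability.Percolation.openConn x y)ᶜ ∩ (Literature.Probability.Percolation.openConn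 x z)ᶜ) * ((Literature.Probability.LatticeModels.prodBernoulli w).real (Literature.Probability.Percolation.openConn y z)ᶜ * (∫ ω in Literature.Probability.Percolation.openConn o y ∩ (Literature.Probability.Percolation.openConn y z)ᶜ, G (Literature.Probability.Percolation.openEdgeCluster ω y) ∂(Literature.Probability.LatticeModels.prodBernoulli w)) - (Literature.Probability.LatticeModels.prodBernoulli w).real (Literature.Probability.Percolation.openConn o y ∩ (Literature.Probability.Percolation.openConn y z)ᶜ) * (∫ ω in (Literature.Probability.Percolation.openConn y z)ᶜ, G (Literature.Probability.Percolation.openEdgeCluster ω y) ∂(Literature.Probability.LatticeModels.prodBernoulli w))) :=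
  fun hM _ w o x y z hxy hxz hyz G hG => s1m_s1gen_of_exchM w o x y z hyz G hG (hM _ w o x y z hxy hxz hyz G hG)

end

end Summit.CriticalPhenomena.PercolationContinuityZ3.Theorems
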